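import Literature.MathematicalPhysics.QuantumLattice.YangMillsSphericalSplit
import Literature.MathematicalPhysics.QuantumLattice.YangMillsTangentialCurvature
import Literature.MathematicalPhysics.QuantumLattice.YangMillsStressEnergy
import Literature.Analysis.Calculus.AngularMomentumFieldsPolar
import HarnessLib

/-!
# The total angular momentum on the curvature and the Casimir split of the covariant Laplacian

QuantumLattice support file (everything proved; one definition, no named facts) on the proof
path of `Literature.MathematicalPhysics.QuantumLattice.Waldron2019_yangMillsFlow_flatTorus`
(A. Waldron, Invent. math. 217 (2019)), §4 done EXTRINSICALLY: instead of Waldron's intrinsic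
`−Δ_θ` on `Ω²(S³, 𝔤)` we use the (covariant) total angular momentum
`J_{ij} = ∇_{L_{ij}} + S_{ij}` acting on 2-form fields,
`(J_{ij}β)_y(a,c) = D_{L_{ij}(y)}[β(a,c)](y) + β_y(L_{ij}a, c) + β_y(a, L_{ij}c)`,
whose square `½∑ᵢ∑ⱼ J_{ij}²` restricted to tangential arguments is `−Δ_θ` up to curvature terms.
The main result is the **Casimir split** of the flat covariant Laplacian of the curvature: for
tangential `a, c ⊥ x` (`n = dim E`, `φ = F(·)(a,c)`),

`‖x‖² ∑ₖ DₖDₖφ(x) = ½∑ᵢ∑ⱼ (J_{ij}(J_{ij}F))_x(a,c) + D_xD_xφ(x) + (n+1) D_xφ(x) + 2(n−2) F_x(a,c)`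

(for `n = 4`: `D_xD_x + 5D_x + 4 = ∂ₛ²` of `Ω = r²F_tan`, Waldron's (4.i)). Ingredients: the
spherical split on sections (`YangMillsSphericalSplit`), the polarized frame identity
(`AngularMomentumFieldsPolar`) for the orbit–spin cross terms, which the Bianchi identity
(`covDeriv_curvature_cyclic_holds`) turns into `−2 D_xφ`, and the spin Casimir `−2(n−2)` on
tangential 2-forms.

* `angJ` — the operator `J_{ij}` on 2-form fields; `angJ_angJ_curvature` — its square expanded;
* `sum_sum_curvature_angularField_angularField`, `sum_sum_curvature_angularField₂` — spin sums;
* `sum_sum_covDeriv_curvature_cross₁/₂` — the cross sums via the polar identity;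
* `casimir_split_curvature` — the displayed identity.

References: A. Waldron, Invent. math. 217 (2019), §4.1–4.2, (4.i) [Waldron2019].
-/

noncomputable section

open scoped RealInnerProductSpace Topology
open Literature.Analysis.Calculus

namespace Literature.MathematicalPhysics.QuantumLattice

section Casimir

variable {E : Type*} [NormedAddCommGroup E] [InnerProductSpace ℝ E]
variable {𝔸 : Type*} [NormedRing 𝔸] [NormedAlgebra ℝ 𝔸]
variable {ι : Type*} [Fintype ι]

/-- **The total angular momentum `J_{ij}` on 2-form fields** (covariant Lie derivative along the
rotation field `L_{ij}`):
`(J_{ij}β)_y(a,c) = D_{L_{ij}y}[β(a,c)](y) + β_y(L_{ij}a, c) + β_y(a, L_{ij}c)`. [folklore] -/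
def angJ (b : OrthonormalBasis ι ℝ E) (i j : ι) (A : Connection E 𝔸) (β : E → E → E → 𝔸)
    (y : E) (a c : E) : 𝔸 :=
  covDeriv A (fun z => β z a c) y (angularField b i j y) + β y (angularField b i j a) c +
    β y a (angularField b i j c)

/-! ### Spin sums -/

/-- `∑ᵢ∑ⱼ F(L_{ij}(L_{ij}a), c) = −2(n−1) F(a, c)`. [folklore] -/
theorem sum_sum_curvature_angularField_angularField [DecidableEq ι] (b : OrthonormalBasis ι ℝ E)
    {A : Connection E 𝔸} {x : E} (hA : DifferentiableAt ℝ A x) (a c : E) :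
    ∑ i, ∑ j, curvature A x (angularField b i j (angularField b i j a)) c =
      (-(2 * ((Fintype.card ι : ℝ) - 1))) • curvature A x a c := by
  simp_rw [← curvatureCLM_apply hA]
  rw [show ∑ i, ∑ j, curvatureCLM A x (angularField b i j (angularField b i j a)) c =
      curvatureCLM A x (∑ i, ∑ j, angularField b i j (angularField b i j a)) c by
    simp only [map_sum, FunLike.coe_sum, Finset.sum_apply],
    sum_sum_angularField_angularField b a, map_smul, FunLike.coe_smul, Pi.smul_apply]

/-- `∑ᵢ∑ⱼ F(a, L_{ij}(L_{ij}c)) = −2(n−1) F(a, c)`. [folklore] -/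
theorem sum_sum_curvature_angularField_angularField' [DecidableEq ι] (b : OrthonormalBasis ι ℝ E)
    {A : Connection E 𝔸} {x : E} (hA : DifferentiableAt ℝ A x) (a c : E) :
    ∑ i, ∑ j, curvature A x a (angularField b i j (angularField b i j c)) =
      (-(2 * ((Fintype.card ι : ℝ) - 1))) • curvature A x a c := by
  simp_rw [← curvatureCLM_apply hA]
  rw [show ∑ i, ∑ j, curvatureCLM A x a (angularField b i j (angularField b i j c)) =
      curvatureCLM A x a (∑ i, ∑ j, angularField b i j (angularField b i j c)) by
    simp only [map_sum], sum_sum_angularField_angularField b c, map_smul]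

/-- `∑ᵢ∑ⱼ F(L_{ij}a, L_{ij}c) = 2 F(a, c)` (polar identity; `F` antisymmetric). [folklore] -/
theorem sum_sum_curvature_angularField₂ (b : OrthonormalBasis ι ℝ E) {A : Connection E 𝔸}
    {x : E} (hA : DifferentiableAt ℝ A x) (a c : E) :
    ∑ i, ∑ j, curvature A x (angularField b i j a) (angularField b i j c) =
      (2 : ℝ) • curvature A x a c := by
  simp_rw [← curvatureCLM_apply hA]
  rw [sum_sum_bilinear_angularField_polar_vec b (curvatureCLM A x) a c]
  have h0 : ∀ k, curvatureCLM A x (b k) (b k) = 0 := fun k => by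
    rw [curvatureCLM_apply hA]
    have := curvature_antisymm A x (b k) (b k)
    -- `F(u,u) = −F(u,u)` forces `F(u,u) = 0`
    have h2 : (2 : ℝ) • curvature A x (b k) (b k) = 0 := by
      rw [two_smul]; nth_rewrite 2 [this]; exact add_neg_cancel _
    exact (smul_eq_zero.1 h2).resolve_left two_ne_zero
  simp only [h0, Finset.sum_const_zero, smul_zero, zero_sub, smul_neg]
  rw [curvatureCLM_apply hA, curvatureCLM_apply hA, curvature_antisymm A x c a, smul_neg, neg_neg]

/-! ### The first covariant derivative of the curvature as a bilinear map, and the cross sums -/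

/-- Evaluation of the last slot: `evalLast c T = (w ↦ T w c)`. [folklore] -/
def evalLast (c : E) : (E →L[ℝ] E →L[ℝ] 𝔸) →L[ℝ] (E →L[ℝ] 𝔸) :=
  ContinuousLinearMap.compL ℝ E (E →L[ℝ] 𝔸) 𝔸 (ContinuousLinearMap.apply ℝ 𝔸 c)

/-- Unfolding lemma. [folklore] -/
@[simp] theorem evalLast_apply (c : E) (T : E →L[ℝ] E →L[ℝ] 𝔸) (w : E) :
    evalLast (𝔸 := 𝔸) c T w = T w c := rfl

/-- The bracket part `(v, w) ↦ [A_x v, K w]` as a continuous bilinear map. [folklore] -/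
def bracketCLM (A : Connection E 𝔸) (x : E) (K : E →L[ℝ] 𝔸) : E →L[ℝ] E →L[ℝ] 𝔸 :=
  (((ContinuousLinearMap.compL ℝ E 𝔸 𝔸).flip K).comp ((ContinuousLinearMap.mul ℝ 𝔸).comp (A x))) -
    (((ContinuousLinearMap.compL ℝ E 𝔸 𝔸).flip K).comp
      ((ContinuousLinearMap.mul ℝ 𝔸).flip.comp (A x)))

/-- Unfolding lemma. [folklore] -/
@[simp] theorem bracketCLM_apply (A : Connection E 𝔸) (x : E) (K : E →L[ℝ] 𝔸) (v w : E) :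
    bracketCLM A x K v w = ⁅A x v, K w⁆ := by
  simp [bracketCLM, Ring.lie_def]

/-- `(v, w) ↦ D_v[z ↦ F_z(w, c)](x)` as a continuous bilinear map. [folklore] -/
def covDerivCurv₁ (A : Connection E 𝔸) (x c : E) : E →L[ℝ] E →L[ℝ] 𝔸 :=
  ((evalLast (𝔸 := 𝔸) c).comp (fderiv ℝ (curvatureCLM A) x) : E →L[ℝ] E →L[ℝ] 𝔸) +
    bracketCLM A x ((evalLast (𝔸 := 𝔸) c) (curvatureCLM A x))

/-- `(v, w) ↦ D_v[z ↦ F_z(a, w)](x)` as a continuous bilinear map. [folklore] -/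
def covDerivCurv₂ (A : Connection E 𝔸) (x a : E) : E →L[ℝ] E →L[ℝ] 𝔸 :=
  ((ContinuousLinearMap.apply ℝ (E →L[ℝ] 𝔸) a).comp (fderiv ℝ (curvatureCLM A) x) :
      E →L[ℝ] E →L[ℝ] 𝔸) +
    bracketCLM A x (curvatureCLM A x a)

/-- The derivative of `z ↦ F_z(w, c)` through `curvatureCLM`. [folklore] -/
theorem fderiv_curvature_apply₁ {A : Connection E 𝔸} (hA : ContDiff ℝ 2 A) (x v w c : E) :
    fderiv ℝ (fun z => curvature A z w c) x v = fderiv ℝ (curvatureCLM A) x v w c := by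
  have hAd : Differentiable ℝ A := hA.differentiable two_ne_zero
  have hB := differentiableAt_curvatureCLM hA x
  rw [show (fun z => curvature A z w c) = fun z => curvatureCLM A z w c from
    funext fun z => (curvatureCLM_apply (hAd z) w c).symm]
  have h1 : DifferentiableAt ℝ (fun z => curvatureCLM A z w) x :=
    DifferentiableAt.clm_apply (𝕜 := ℝ) (G := E) (H := E →L[ℝ] 𝔸) (c := curvatureCLM A)
      (u := fun _ => w) hB (differentiableAt_const w)
  rw [fderiv_clm_apply (𝕜 := ℝ) (G := E) (H := 𝔸) (c := fun z => curvatureCLM A z w)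
      (u := fun _ => c) h1 (differentiableAt_const c),
    fderiv_clm_apply (𝕜 := ℝ) (G := E) (H := E →L[ℝ] 𝔸) (c := curvatureCLM A)
      (u := fun _ => w) hB (differentiableAt_const w)]
  simp

/-- `covDerivCurv₁ A x c v w = D_v[z ↦ F_z(w,c)](x)`. [folklore] -/
theorem covDerivCurv₁_apply {A : Connection E 𝔸} (hA : ContDiff ℝ 2 A) (x c v w : E) :
    covDerivCurv₁ A x c v w = covDeriv A (fun z => curvature A z w c) x v := by
  have hAd : Differentiable ℝ A := hA.differentiable two_ne_zero
  rw [covDeriv, fderiv_curvature_apply₁ hA]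
  simp [covDerivCurv₁, curvatureCLM_apply (hAd x)]

/-- `covDerivCurv₂ A x a v w = D_v[z ↦ F_z(a,w)](x)`. [folklore] -/
theorem covDerivCurv₂_apply {A : Connection E 𝔸} (hA : ContDiff ℝ 2 A) (x a v w : E) :
    covDerivCurv₂ A x a v w = covDeriv A (fun z => curvature A z a w) x v := by
  have hAd : Differentiable ℝ A := hA.differentiable two_ne_zero
  rw [covDeriv, fderiv_curvature_apply₁ hA]
  simp [covDerivCurv₂, curvatureCLM_apply (hAd x)]

/-- **First cross sum**: `∑ᵢ∑ⱼ D_{L_{ij}x}[F(L_{ij}a, c)] = 2(⟨x,a⟩ ∑ₖ D_{bₖ}[F(bₖ,c)] − D_a[F(x,c)])`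
(frozen vector arguments inside `F`). [folklore] -/
theorem sum_sum_covDeriv_curvature_cross₁ (b : OrthonormalBasis ι ℝ E) {A : Connection E 𝔸}
    (hA : ContDiff ℝ 2 A) (x a c : E) :
    ∑ i, ∑ j, covDeriv A (fun z => curvature A z (angularField b i j a) c) x (angularField b i j x) =
      (2 : ℝ) • (⟪x, a⟫ • ∑ k, covDeriv A (fun z => curvature A z (b k) c) x (b k) -
        covDeriv A (fun z => curvature A z x c) x a) := by
  simp_rw [← covDerivCurv₁_apply hA]
  exact sum_sum_bilinear_angularField_polar_vec b (covDerivCurv₁ A x c) x a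

/-- **Second cross sum**: `∑ᵢ∑ⱼ D_{L_{ij}x}[F(a, L_{ij}c)] = 2(⟨x,c⟩ ∑ₖ D_{bₖ}[F(a,bₖ)] − D_c[F(a,x)])`.
[folklore] -/
theorem sum_sum_covDeriv_curvature_cross₂ (b : OrthonormalBasis ι ℝ E) {A : Connection E 𝔸}
    (hA : ContDiff ℝ 2 A) (x a c : E) :
    ∑ i, ∑ j, covDeriv A (fun z => curvature A z a (angularField b i j c)) x (angularField b i j x) =
      (2 : ℝ) • (⟪x, c⟫ • ∑ k, covDeriv A (fun z => curvature A z a (b k)) x (b k) -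
        covDeriv A (fun z => curvature A z a x) x c) := by
  simp_rw [← covDerivCurv₂_apply hA]
  exact sum_sum_bilinear_angularField_polar_vec b (covDerivCurv₂ A x a) x c

/-! ### The square of `J` on the curvature -/

/-- Differentiability of `z ↦ D_{L z}φ(z)` for `φ ∈ C²` (through `covDerivCLM`). [folklore] -/
theorem differentiableAt_covDeriv_angularField (b : OrthonormalBasis ι ℝ E) (i j : ι)
    {A : Connection E 𝔸} {φ : E → 𝔸} {x : E} (hA : DifferentiableAt ℝ A x)
    (hφ : DifferentiableAt ℝ φ x) (hφ2 : DifferentiableAt ℝ (fderiv ℝ φ) x) :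
    DifferentiableAt ℝ (fun z => covDeriv A φ z (angularField b i j z)) x := by
  have hC := differentiableAt_covDerivCLM hA hφ hφ2
  have hL : DifferentiableAt ℝ (angularField b i j) x := (hasFDerivAt_angularField b i j x).differentiableAt
  have h : DifferentiableAt ℝ (fun z => covDerivCLM A φ z (angularField b i j z)) x :=
    DifferentiableAt.clm_apply (𝕜 := ℝ) (G := E) (H := 𝔸) (c := covDerivCLM A φ)
      (u := angularField b i j) hC hL
  refine h.congr_of_eventuallyEq (Filter.Eventually.of_forall fun z => ?_)
  exact (covDerivCLM_apply A φ z _).symm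

/-- **The square of the total angular momentum on the curvature, expanded**:
`J(JF)(a,c) = D_{Lx}[z ↦ D_{Lz}φ] + 2 D_{Lx}[F(La,c)] + 2 D_{Lx}[F(a,Lc)] + F(LLa,c) + 2F(La,Lc) + F(a,LLc)`
with `φ = F(·)(a,c)`, `L = L_{ij}`, for `A ∈ C³`. [folklore] -/
theorem angJ_angJ_curvature (b : OrthonormalBasis ι ℝ E) (i j : ι) {A : Connection E 𝔸}
    (hA : ContDiff ℝ 3 A) (x a c : E) :
    angJ b i j A (angJ b i j A fun y u v => curvature A y u v) x a c =
      covDeriv A (fun y => covDeriv A (fun z => curvature A z a c) y (angularField b i j y)) x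
          (angularField b i j x) +
        (2 : ℝ) • covDeriv A (fun z => curvature A z (angularField b i j a) c) x (angularField b i j x) +
        (2 : ℝ) • covDeriv A (fun z => curvature A z a (angularField b i j c)) x (angularField b i j x) +
        curvature A x (angularField b i j (angularField b i j a)) c +
        (2 : ℝ) • curvature A x (angularField b i j a) (angularField b i j c) +
        curvature A x a (angularField b i j (angularField b i j c)) := by
  have hA3 : ContDiff ℝ (2 + 1) A := by rw [show ((2 : WithTop ℕ∞) + 1) = 3 by norm_num]; exact hA
  have hF2 : ∀ u w, ContDiff ℝ 2 (fun y => curvature A y u w) := fun u w =>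
    contDiff_curvature_apply hA3 u w
  have hFd : ∀ u w, DifferentiableAt ℝ (fun y => curvature A y u w) x := fun u w =>
    (hF2 u w).differentiable two_ne_zero x
  have hFd2 : ∀ u w, DifferentiableAt ℝ (fderiv ℝ fun y => curvature A y u w) x := fun u w =>
    ((hF2 u w).fderiv_right (m := 1) (by norm_num)).differentiable one_ne_zero x
  have hAd : DifferentiableAt ℝ A x := hA.differentiable (by norm_num) x
  have hT1 : DifferentiableAt ℝ
      (fun z => covDeriv A (fun z' => curvature A z' a c) z (angularField b i j z)) x :=
    differentiableAt_covDeriv_angularField b i j hAd (hFd a c) (hFd2 a c)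
  -- unfold both `J`'s (with beta reduction), then split the derivative of the inner sum
  simp only [angJ]
  have hT12 : DifferentiableAt ℝ (fun z => covDeriv A (fun z' => curvature A z' a c) z
      (angularField b i j z) + curvature A z (angularField b i j a) c) x := hT1.add (hFd _ _)
  rw [covDeriv_fun_add A (φ := fun z => covDeriv A (fun z' => curvature A z' a c) z
      (angularField b i j z) + curvature A z (angularField b i j a) c)
      (ψ := fun z => curvature A z a (angularField b i j c)) hT12 (hFd _ _),
    covDeriv_fun_add A (φ := fun z => covDeriv A (fun z' => curvature A z' a c) z
      (angularField b i j z)) (ψ := fun z => curvature A z (angularField b i j a) c) hT1 (hFd _ _)]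
  simp only [two_smul]
  abel

/-! ### The Casimir split -/

/-- **The Casimir split of the flat covariant Laplacian of the curvature** (tangential
arguments `a, c ⊥ x`, `A ∈ C³`, `n = dim E`, `φ = F(·)(a,c)`):
`‖x‖² ∑ₖ DₖDₖφ(x) = ½∑ᵢ∑ⱼ (J_{ij}(J_{ij}F))_x(a,c) + D_xD_xφ(x) + (n+1) D_xφ(x) + 2(n−2) F_x(a,c)`
— the orbit–spin cross terms are `−2D_xφ` by the Bianchi identity and the spin Casimir on
tangential 2-forms is `−2(n−2)`; for `n = 4` the radial part is `D_xD_x + 5D_x + 4 = ∂ₛ²` of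
`Ω = r² F_tan`, i.e. Waldron's `(∂ₛ² − Δ_θ)Ω` split of `r⁴(∇^*∇F)_tan`.
[cite: Waldron2019, §4.1–4.2, (4.i)] -/
theorem casimir_split_curvature [DecidableEq ι] (b : OrthonormalBasis ι ℝ E) {A : Connection E 𝔸}
    (hA : ContDiff ℝ 3 A) {x a c : E} (ha : ⟪x, a⟫ = 0) (hc : ⟪x, c⟫ = 0) :
    ‖x‖ ^ 2 • ∑ k, covDeriv A (fun y => covDeriv A (fun z => curvature A z a c) y (b k)) x (b k) =
      (1 / 2 : ℝ) • ∑ i, ∑ j, angJ b i j A (angJ b i j A fun y u v => curvature A y u v) x a c +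
        covDeriv A (fun y => covDeriv A (fun z => curvature A z a c) y x) x x +
        ((Fintype.card ι : ℝ) + 1) • covDeriv A (fun z => curvature A z a c) x x +
        (2 * ((Fintype.card ι : ℝ) - 2)) • curvature A x a c := by
  have hA2 : ContDiff ℝ 2 A := hA.of_le (by norm_num)
  have hA3 : ContDiff ℝ (2 + 1) A := by rw [show ((2 : WithTop ℕ∞) + 1) = 3 by norm_num]; exact hA
  have hF2 : ContDiff ℝ 2 (fun y => curvature A y a c) := contDiff_curvature_apply hA3 a c
  have hφ : DifferentiableAt ℝ (fun y => curvature A y a c) x := hF2.differentiable two_ne_zero x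
  have hφ2 : DifferentiableAt ℝ (fderiv ℝ fun y => curvature A y a c) x :=
    (hF2.fderiv_right (m := 1) (by norm_num)).differentiable one_ne_zero x
  have hAd : DifferentiableAt ℝ A x := hA.differentiable (by norm_num) x
  -- ### sum the expansion
  simp_rw [angJ_angJ_curvature b _ _ hA x a c]
  simp only [Finset.sum_add_distrib, ← Finset.smul_sum]
  rw [sum_sum_covDeriv_covDeriv_angularField b hAd hφ hφ2,
    sum_sum_covDeriv_curvature_cross₁ b hA2 x a c, sum_sum_covDeriv_curvature_cross₂ b hA2 x a c,
    sum_sum_curvature_angularField_angularField b hAd a c,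
    sum_sum_curvature_angularField_angularField' b hAd a c, sum_sum_curvature_angularField₂ b hAd a c,
    ha, hc, zero_smul, zero_smul, zero_sub, zero_sub]
  -- ### Bianchi: `D_a[F(x,c)] + D_x[F(c,a)] + D_c[F(a,x)] = 0`
  have hB := covDeriv_curvature_cyclic_holds A hA2 x a x c
  have hanti : covDeriv A (fun y => curvature A y c a) x x =
      -covDeriv A (fun y => curvature A y a c) x x := by
    rw [← covDeriv_fun_neg]
    congr 1
    funext y
    exact curvature_antisymm A y c a
  rw [hanti] at hB
  have hP : covDeriv A (fun y => curvature A y x c) x a =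
      covDeriv A (fun y => curvature A y a c) x x - covDeriv A (fun y => curvature A y a x) x c := by
    rw [← sub_eq_zero]
    have : covDeriv A (fun y => curvature A y x c) x a -
        (covDeriv A (fun y => curvature A y a c) x x - covDeriv A (fun y => curvature A y a x) x c) =
        covDeriv A (fun y => curvature A y x c) x a + -covDeriv A (fun y => curvature A y a c) x x +
          covDeriv A (fun y => curvature A y a x) x c := by abel
    rw [this, hB]
  rw [hP]
  module

end Casimir

end Literature.MathematicalPhysics.QuantumLattice
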